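import Summits.QuantumAdvantage.QuantumAdvantage.Theorems.CubicForrelationNearExactIsExactBentDuality
import Summits.QuantumAdvantage.QuantumAdvantage.Theorems.CubicForrelationNearExactIsExactQuadPerturb
import Summits.QuantumAdvantage.QuantumAdvantage.Theorems.CubicForrelationSignedCubicForrelationNotPrBPPStubKernelNormalFormDegree
import Literature.Computability.QuantumComplexity.ForrelationDirectSum
import Literature.Computability.QuantumComplexity.SignedForrelationGadget

/-!
# Crux `CubicForrelation.NearExactIsExact` (stmt-QuantumAdvantage-14043), line `direct-sum-amplification` —
stub VG: value granularity of the forrelation of a cubic pair (McEliece divisibility read on the value)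

For ANY Boolean `f` and a CUBIC `g` on `n = m + m` bits, the scaled forrelation `2^{3m} Φ(f,g)` is an integer
multiple of `2^{⌈n/3⌉} = 2^{(m+m+2)/3}` (`stub_valueGranularity`), GIVEN Ax's / McEliece's divisibility theorem on
coordinate cubes in the form of the landed stub `stub_axParity` (taken here as the HYPOTHESIS `hAx`, exactly its
statement; it is never re-proved or restated as a fact).

Proof. `2^{3m} Φ(f,g) = Σ_x (−1)^{f(x)} W_g(x)` with `W_g(x) = Σ_y (−1)^{g(y)} (−1)^{y·x}` (`fsum_signOf_eq`,
`fsum_eq_sum_mul_W`, and `√(2^{3(m+m)}) = 2^{3m}` = the landed `qp_sqrt_two_pow_three_mul_add_self`: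
`vg_two_pow_mul_forrelation`). For a fixed `x` the twist `(−1)^{y·x} = (−1)^{#{i : yᵢ ∧ xᵢ}}`
(`Simon.twist_eq_neg_one_pow`, `SgnForrMem.signOf_decide_odd`) is the sign of the PARITY
`y ↦ [#{i : yᵢ ∧ xᵢ} odd]`, an affine function of `y` (`knf_isDegLeFun_ip`: it is the polynomial `Σ_{i : xᵢ} Yᵢ`), so
`W_g(x) = Σ_y (−1)^{g(y) ⊕ [y·x odd]}` (`signOf_xor`) is the bias of the CUBIC function `g ⊕ ℓ_x`
(`bb_isDegLeFun_bxor`), hence `W_g(x) ∈ 2^{⌈n/3⌉} ℤ` by `hAx` with `K = univ`, `d = 3` (`vg_W_granular`;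
`⌈n/3⌉ = (n + 3 − 1)/3 = (n+2)/3`). Summing, `2^{3m} Φ = 2^{(m+m+2)/3} · Σ_x (± z_x)`.

Sources: R. J. McEliece, *Weight congruences for p-ary cyclic codes*, Discrete Math. 3 (1972); C. Carlet, *Boolean
Functions for Cryptography and Coding Theory*, CUP 2020, §4.1 (McEliece's theorem); S. Aaronson, A. Ambainis,
*Forrelation*, SIAM J. Comput. 47 (2018), §1.1.1 (`Φ`). Everything below is proved from Mathlib and the tree
(`W`, `fsum_eq_sum_mul_W`, `fsum_signOf_eq`, `qp_sqrt_two_pow_three_mul_add_self`, `Simon.twist_eq_neg_one_pow`,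
`SgnForrMem.signOf_decide_odd`, `signOf_xor`, `bb_isDegLeFun_bxor`, `knf_isDegLeFun_ip`); axioms are the standard three.
-/

set_option linter.dupNamespace false -- D-0017: single-problem summit ⇒ `QuantumAdvantage.QuantumAdvantage` by design

noncomputable section

namespace Summit.QuantumAdvantage.QuantumAdvantage.Theorems.CubicForrelation.NearExactIsExact

open Finset
open Literature.Computability.QuantumComplexity
open Literature.Computability.QuantumComplexity.DerivativeWalsh (W fsum fsum_eq_sum_mul_W fsum_signOf_eq)
open Literature.Computability.QuantumComplexity.SgnForrMem (signOf_decide_odd)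
open Summit.QuantumAdvantage.QuantumAdvantage.Theorems.SignedCubicForrelationNotPrBPP (knf_isDegLeFun_ip)

variable {n : ℕ}

/-! ### The scaled forrelation as a sum of Walsh values -/

/-- `2^{3m} Φ(f,g) = Σ_x (−1)^{f(x)} W_g(x)` on `m + m` bits, `W_g(x) = Σ_y (−1)^{g(y)} (−1)^{y·x}` the
unnormalised Walsh transform of `(−1)^g` (`√(2^{3(m+m)}) = 2^{3m}` is the landed
`qp_sqrt_two_pow_three_mul_add_self`). -/
theorem vg_two_pow_mul_forrelation {m : ℕ} (f g : (Fin (m + m) → Bool) → Bool) :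
    (2 : ℝ) ^ (3 * m) * forrelation f g = ∑ x, signOf (f x) * W (fun y => signOf (g y)) x := by
  rw [← fsum_eq_sum_mul_W, fsum_signOf_eq, qp_sqrt_two_pow_three_mul_add_self]

/-! ### The twist is the sign of an affine function -/

/-- The twist is the sign of the inner-product parity: `(−1)^{y·x} = (−1)^{[#{i : yᵢ ∧ xᵢ} odd]}`
(`Simon.twist_eq_neg_one_pow` with the landed `SgnForrMem.signOf_decide_odd`). -/
theorem vg_twist_eq_signOf (y x : Fin n → Bool) :
    twist y x = signOf (decide (Odd (univ.filter fun i => y i && x i).card)) := by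
  rw [signOf_decide_odd, Simon.twist_eq_neg_one_pow]

/-- `W_g(x) = Σ_y (−1)^{g(y) ⊕ [y·x odd]}`: the Walsh value at `x` is the bias of `g ⊕ ℓ_x`, `ℓ_x(y) = [y·x odd]`. -/
theorem vg_W_eq_sum_signOf_bxor (g : (Fin n → Bool) → Bool) (x : Fin n → Bool) :
    W (fun y => signOf (g y)) x =
      ∑ y, signOf (g y ^^ decide (Odd (univ.filter fun i => y i && x i).card)) := by
  unfold W
  exact sum_congr rfl fun y _ => by rw [signOf_xor, vg_twist_eq_signOf]

/-! ### Granularity of the Walsh values of a cubic function (from AX) -/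

/-- **Walsh values of a cubic function are granular.** Given Ax's theorem on coordinate cubes (`hAx`, the statement
of `stub_axParity`): for CUBIC `g` on `n` bits and every `x`, `W_g(x) = 2^{⌈n/3⌉} · z` for an integer `z`
(`⌈n/3⌉ = (n+2)/3`) — apply `hAx` on the full cube `K = univ` with `d = 3` to the cubic function
`y ↦ g(y) ⊕ [y·x odd]` (`bb_isDegLeFun_bxor`, `knf_isDegLeFun_ip`). -/
theorem vg_W_granular
    (hAx : ∀ (n d : ℕ) (h : (Fin n → Bool) → Bool) (K : Finset (Fin n)), 1 ≤ d → IsDegLeFun d h →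
      ∃ z : ℤ, ∑ x ∈ {u : Fin n → Bool | ∀ i, u i = true → i ∈ K}, signOf (h x) =
        (2 : ℝ) ^ ((K.card + d - 1) / d) * (z : ℝ))
    (g : (Fin n → Bool) → Bool) (hg : IsDegLeFun 3 g) (x : Fin n → Bool) :
    ∃ z : ℤ, W (fun y => signOf (g y)) x = (2 : ℝ) ^ ((n + 2) / 3) * (z : ℝ) := by
  have hdeg : IsDegLeFun 3 (fun y : Fin n → Bool =>
      g y ^^ decide (Odd (univ.filter fun i => y i && x i).card)) :=
    bb_isDegLeFun_bxor hg ((knf_isDegLeFun_ip x).mono (by norm_num))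
  obtain ⟨z, hz⟩ := hAx n 3 _ univ (by norm_num) hdeg
  refine ⟨z, ?_⟩
  have he : (n + 3 - 1) / 3 = (n + 2) / 3 := by omega
  rw [filter_true_of_mem (fun u _ i _ => mem_univ i), card_fin, he] at hz
  rw [vg_W_eq_sum_signOf_bxor, hz]

/-! ### The stub -/

/-- **stub_valueGranularity** (VG; McEliece's divisibility theorem read on the forrelation VALUE). Given Ax's theorem
on coordinate cubes (the first antecedent = the statement of the landed `stub_axParity`): for ANY Boolean `f` and
CUBIC `g` on `m + m` bits, `2^{3m} Φ(f,g) ∈ 2^{⌈2m/3⌉} ℤ = 2^{(m+m+2)/3} ℤ`. Indeed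
`2^{3m} Φ = Σ_x (−1)^{f(x)} W_g(x)` (`vg_two_pow_mul_forrelation`) and every `W_g(x)` lies in `2^{(m+m+2)/3} ℤ`
(`vg_W_granular`). Consequence used by the line (`band_of_small_m`): for `m ≤ 4`, `Φ ∈ 2^{−9} ℤ`, so
`Φ = 1 ∨ Φ ≤ 1 − 2⁻⁹`. -/
theorem stub_valueGranularity :
    (∀ (n d : ℕ) (h : (Fin n → Bool) → Bool) (K : Finset (Fin n)), 1 ≤ d → IsDegLeFun d h →
      ∃ z : ℤ, ∑ x ∈ {u : Fin n → Bool | ∀ i, u i = true → i ∈ K}, signOf (h x) =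
        (2 : ℝ) ^ ((K.card + d - 1) / d) * (z : ℝ)) →
    ∀ (m : ℕ) (f g : (Fin (m + m) → Bool) → Bool), IsDegLeFun 3 g →
      ∃ z : ℤ, (2 : ℝ) ^ (3 * m) * forrelation f g = (2 : ℝ) ^ ((m + m + 2) / 3) * (z : ℝ) := by
  intro hAx m f g hg
  choose z hz using fun x => vg_W_granular hAx g hg x
  refine ⟨∑ x, (if f x then -z x else z x), ?_⟩
  rw [vg_two_pow_mul_forrelation, Int.cast_sum, mul_sum]
  refine sum_congr rfl fun x _ => ?_
  rw [hz x]
  rcases Bool.eq_false_or_eq_true (f x) with h | h <;> simp [h, signOf]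

end Summit.QuantumAdvantage.QuantumAdvantage.Theorems.CubicForrelation.NearExactIsExact
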